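import Summits.ResolutionOfSingularities.ResolutionOfSingularities.Theses.HomologicalConductor
import Summits.ResolutionOfSingularities.ResolutionOfSingularities.Theorems.HomologicalConductorStrictDropRegularDrop
import Summits.ResolutionOfSingularities.ResolutionOfSingularities.Theorems.HomologicalConductorStrictDropTowerShape
import Summits.ResolutionOfSingularities.ResolutionOfSingularities.Theorems.HomologicalConductorNoZenoIffKernel
import HarnessLib

/-!
# Crux `StrictDrop` (stmt-ResolutionOfSingularities-16485) in dimension two FOLLOWS from the kill test
# `SurfaceTermination` (stmt-ResolutionOfSingularities-16488) — fact-free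

Route `ResolutionOfSingularities/HomologicalConductor`.  OURS (cell decomp-res, hand leafhand-res-homologicalconduct-3);
AI-written support lemma, weaker than expert review; nothing here is a statement of any manuscript under review.
SUPPORT-level: a door between two OPEN leaves of one route; neither leaf, nor the route, nor resolution of singularities
in positive characteristic is proved here.

The tree has the direction `StrictDrop → SurfaceTermination` modulo the six published surface facts
(`SurfaceTermination.Reduction.surfaceTermination_of_strictDrop`, res-L0-w44-stub-3) and, fact-free,
`StrictDrop → PrimeDivisorSurfaceTermination`.  This file records the CONVERSE on the slice where the two items
overlap, fact-free:

* `strictDrop_dimTwo_of_surfaceTermination` — **`SurfaceTermination` ⇒ `StrictDrop` for data with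
  `ringKrullDim A = 2`**, i.e. the route's `StrictDrop` text verbatim with the kill test's extra binder
  `ringKrullDim ↥A = 2 →` inserted at the kill test's position.  Proof: the kill test gives a regular stage `T_M`;
  regular stages persist (`NoZeno.Birth.tower_succ_eq_self_of_isRegularLocalRing`), so for a SINGULAR stage `T_m`
  a stage `T_(M+j) ` with `M + j = max M (m+1)` is regular and later than `m`, and the landed endpoint calibration SC
  (`RegularDrop.stub_regular_drop`: a regular stage carries the annihilator `1`, of value below every non-zero
  annihilator of a singular stage — those lie in the centre) supplies the witness; the tower `Shape` SC consumes is
  the landed S0 (`TowerShape.stub_towerShape`).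
* `dichotomy_dimGETwo_dimTwo_of_surfaceTermination` — hence the registered KERNEL `stub_dichotomy_dimGETwo` of the
  line `birth` (≡ the crux, `KernelIff.dichotomy_dimGETwo_iff_strictDrop`) holds on the same slice, by its left
  disjunct.  Together with `NoZeno.Birth.exists_ringKrullDim_tower_eventually_eq` (the Krull dimension of the stages
  is eventually constant, `HomologicalConductorStrictDropTowerDimAntitone`) this isolates what is crux-sized in
  `StrictDrop`: runs of singular stages of terminal dimension `e ≥ 3`, and terminal dimension `2` at centres of
  positive residue transcendence degree (re-grounding over a transcendence basis of the residue field would feed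
  them to the kill test; not done here).

References (mechanism only): S. B. Iyengar, R. Takahashi, IMRN 2016, Example 2.5 and Lemma 2.10 [`IyengarTakahashi2014`].
-/

noncomputable section

-- single-problem summit: the doubled namespace component `ResolutionOfSingularities` is forced
set_option linter.dupNamespace false

open Summit.ResolutionOfSingularities.ResolutionOfSingularities.Theses.HomologicalConductor (StrictDrop SurfaceTermination)

namespace Summit.ResolutionOfSingularities.ResolutionOfSingularities.Theorems.StrictDrop.Birth.OfTermination

/-- **`SurfaceTermination` ⇒ `StrictDrop` in dimension two** (fact-free): for the route's datum with
`ringKrullDim A = 2`, if the canonical normalised `ca`-tower along `O` reaches a regular stage (the kill test), then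
from every singular stage `T_m` some later stage carries a non-zero annihilator of `O`-value strictly below all of
`ca(T_m) ∖ 0` — namely `1` on the regular stage `T_(max M (m+1))` (regular stages persist; SC
`RegularDrop.stub_regular_drop` over S0 `TowerShape.stub_towerShape`).  The statement is the route's `StrictDrop`
verbatim with the binder `ringKrullDim ↥A = 2 →` of `SurfaceTermination` inserted.
[cite: IyengarTakahashi2014, Example 2.5 and Lemma 2.10 (2)] -/
theorem strictDrop_dimTwo_of_surfaceTermination (hS : SurfaceTermination) :
    ∀ p : ℕ, p.Prime → ∀ (k K : Type) [Field k] [CharP k p] [Field K] [Algebra k K] (O : ValuationSubring K) (A : Subalgebra k K), (∀ c : k, algebraMap k K c ∈ O) → A.FG → IsFractionRing ↥A K → A.toSubring ≤ O.toSubring → ringKrullDim ↥A = 2 → let ca : Subalgebra k K → Set K := fun A => {x : K | ∃ hx : x ∈ A, ∃ n : ℕ, ∀ i : ℕ, n ≤ i → ∀ (M N : ModuleCat.{0} ↥A), Module.Finite ↥A M → Module.Finite ↥A N → ∀ e : CategoryTheory.Abelian.Ext.{0} M N i, (⟨x, hx⟩ : ↥A) • e = 0}; let loc : Subalgebra k K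 → Subalgebra k K := fun A => Algebra.adjoin k {y : K | ∃ a ∈ A, ∃ s ∈ A, s⁻¹ ∈ O ∧ y = a * s⁻¹}; let chart : Subalgebra k K → Subalgebra k K := fun A => Algebra.adjoin k ((A : Set K) ∪ {y : K | ∃ c ∈ ca A, ∃ x ∈ ca A, x ≠ 0 ∧ (∀ c' ∈ ca A, c' * x⁻¹ ∈ O) ∧ y = c * x⁻¹}); let nrm : Subalgebra k K → Subalgebra k K := fun B => Algebra.adjoin k {y : K | IsIntegral ↥B y}; let tower : Subalgebra k K → ℕ → Subalgebra k K := fun A m => @Nat.rec (fun _ => Subalgebra k K) (loc A) (fun _ B => loc (nrm (chart B))) m; ∀ m : ℕ, ¬ IsRegularLocalRing ↥(tower A m) → ∃ m' : ℕ, m < m' ∧ ∃ y ∈ ca (tower A m'), y ≠ 0 ∧ ∀ x ∈ ca (tower A m), x ≠ 0 → y * x⁻¹ ∉ O := by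
  intro p hp k K _ _ _ _ O A hk hA hfr hAO hdim ca loc chart nrm tower m hm
  -- the kill test: a regular stage `M`
  obtain ⟨M, hregM⟩ : ∃ M : ℕ, IsRegularLocalRing ↥(tower A M) := hS p hp k K O A hk hA hfr hAO hdim
  -- regular stages persist: `T_(M+j)` is regular for every `j`
  have hpersist : ∀ j : ℕ, IsRegularLocalRing ↥(tower A (M + j)) := by
    intro j
    induction j with
    | zero => exact hregM
    | succ j ih =>
      have hstat : tower A (M + j + 1) = tower A (M + j) :=
        NoZeno.Birth.tower_succ_eq_self_of_isRegularLocalRing O A hk hfr hAO (M + j) ih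
      rw [← Nat.add_assoc, hstat]
      exact ih
  -- the regular stage `n := max M (m + 1)` is later than the singular stage `m`
  obtain ⟨j, hj⟩ := Nat.exists_eq_add_of_le (le_max_left M (m + 1))
  have hregn : IsRegularLocalRing ↥(tower A (M + j)) := hpersist j
  have hmn : m < M + j := by
    rw [← hj]
    exact Nat.lt_of_lt_of_le (Nat.lt_succ_self m) (le_max_right M (m + 1))
  -- SC over S0
  have hshape := TowerShape.stub_towerShape p hp k K O A hk hA hfr hAO
  obtain ⟨y, hy, hy0, hval⟩ :=
    RegularDrop.stub_regular_drop p hp k K O A hk hA hfr hAO hshape m (M + j) hm hregn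
  exact ⟨M + j, hmn, y, hy, hy0, hval⟩

/-- **The registered kernel `stub_dichotomy_dimGETwo` of line `birth` on the dimension-two slice, from the kill
test** (fact-free): its text verbatim with the binder `ringKrullDim ↥A = 2 →` inserted; by the left disjunct
(`strictDrop_dimTwo_of_surfaceTermination` at the singular stage `m`). [folklore] -/
theorem dichotomy_dimGETwo_dimTwo_of_surfaceTermination (hS : SurfaceTermination) :
    ∀ p : ℕ, p.Prime → ∀ (k K : Type) [Field k] [CharP k p] [Field K] [Algebra k K] (O : ValuationSubring K) (A : Subalgebra k K), (∀ c : k, algebraMap k K c ∈ O) → A.FG → IsFractionRing ↥A K → A.toSubring ≤ O.toSubring → ringKrullDim ↥A = 2 → let ca : Subalgebra k K → Set K := fun A => {x : K | ∃ hx : x ∈ A, ∃ n : ℕ, ∀ i : ℕ, n ≤ i → ∀ (M N : ModuleCat.{0} ↥A), Module.Finite ↥A M → Module.Finite ↥A N → ∀ e : CategoryTheory.Abelian.Ext.{0} M N i, (⟨x, hx⟩ : ↥A) • e = 0}; let loc : Subalgebra k K → Subalgebra k K := fun A => Algebra.adjoin k {y : K | ∃ a ∈ A, ∃ s ∈ A,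 s⁻¹ ∈ O ∧ y = a * s⁻¹}; let chart : Subalgebra k K → Subalgebra k K := fun A => Algebra.adjoin k ((A : Set K) ∪ {y : K | ∃ c ∈ ca A, ∃ x ∈ ca A, x ≠ 0 ∧ (∀ c' ∈ ca A, c' * x⁻¹ ∈ O) ∧ y = c * x⁻¹}); let nrm : Subalgebra k K → Subalgebra k K := fun B => Algebra.adjoin k {y : K | IsIntegral ↥B y}; let tower : Subalgebra k K → ℕ → Subalgebra k K := fun A m => @Nat.rec (fun _ => Subalgebra k K) (loc A) (fun _ B => loc (nrm (chart B))) m; let Shape : Subalgebra k K → Prop := fun T => (∃ B : Subalgebra k K, B.FG ∧ B ≤ T ∧ loc B = T ∧ ∀ t ∈ T, ∃ b ∈ B, ∃ s ∈ B, s⁻¹ ∈ O ∧ t = b * s⁻¹) ∧ IsNoetherianRing ↥T ∧ T.toSubring ≤ O.toSubring ∧ ∀ s ∈ T, s⁻¹ ∈ O → s⁻¹ ∈ T; (∀ m : ℕ, Shape (tower A m)) → ∀ m : ℕ, (∀ n : ℕ, m ≤ n → ¬ IsRegularLocalRing ↥(tower A n)) → (∀ n : ℕ, m ≤ n → ¬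 ringKrullDim ↥(tower A n) ≤ 1) → (∃ m' : ℕ, m < m' ∧ ∃ y ∈ ca (tower A m'), y ≠ 0 ∧ ∀ x ∈ ca (tower A m), x ≠ 0 → y * x⁻¹ ∉ O) ∨ ∃ n : ℕ, m ≤ n ∧ tower A (n + 1) = tower A n := by
  intro p hp k K _ _ _ _ O A hk hA hfr hAO hdim ca loc chart nrm tower Shape _ m hsing _
  exact Or.inl
    (strictDrop_dimTwo_of_surfaceTermination hS p hp k K O A hk hA hfr hAO hdim m (hsing m le_rfl))

end Summit.ResolutionOfSingularities.ResolutionOfSingularities.Theorems.StrictDrop.Birth.OfTermination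

end
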